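import Summits.QuantumFields.YangMills.Cruxes.IRcof.Lines.pinned_cofinal_bill
import Summits.QuantumFields.YangMills.Cruxes.IR.Lines.conformal_exit
import HarnessLib

/-!
# LENS-1 «FEMTO → BULK TRANSFER», generation g1 — node sheet for ⟨stmt-QuantumFields-26930⟩ (`BalabanLadder.IRcof`)

Seat `planner-ymfull-r2c-lens-1-g1-0` (R590-ym item (2); operator SUMMON priority19, provocation «recent-theorem open-question
harvest»).  Honesty: `bears_on: R2c`; finite-volume ∕ conditional; **YM mass gap NOT proved**; Assembly 2-of-4 unchanged.

## D-0171 node sheet (pieces → `PinnedExitsCofinalAt (1/24)` → `IRcof` BY NAME)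

Slot of record: `Cruxes/IRcof/Lines/pinned_cofinal_bill.lean` (`PinnedCofinalBill.IRcof_of`; importable twin
`Cruxes.IR.LevelwiseDomination.IRcof_of_pinnedExitsCofinalAt`).  Generation g0 of this lens typed the per-octave laws
`NoHalvingSC` (vacuum sector, `pxcof24_of_noHalving`) and `TwistStepSC` (flux sector, `pxcof24_of_twistStep`).  Generation g1
examined twelve further femto→bulk levers (census `LENS1G1_FEMTOBULK_CENSUS_ymfull_r2c_lens_1_g1.md`, same directory); none
survives the distinctness + costume tests, so NO crux idea card is filed by g1.  This file records, in Lean, the one lever that is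
formally new in currency — the Hellmann–Feynman ∕ β-heredity law for the zero-flux box gap — together with the two-line PROOF that it
is a COSTUME: composed with the (known) strong-coupling anchor it yields a volume-uniform zero-flux lattice gap with an explicit
exponential rate in `β`, i.e. the summit-strength statement (Chatterjee's Problem 5.1(i) with a rate, transfer currency), which is
STRONGER than what `PinnedExitsCofinalAt (1/24)` needs and not weaker than anything in the tree.  Tag: **COSTUME (C3)**; leaf: none.

* `GapHeredityUp βlo κ C` — at FIXED lattice size `L ≥ 8`, raising the coupling from `β₁` to `β₂` (`βlo ≤ β₁ ≤ β₂`) costs the zero-flux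
  gap at most the factor `C · exp(κ (β₂ − β₁))`, uniformly in `L` (the integrated form of `dΔ_L/dβ = ⟨ΣW_p⟩₁ − ⟨ΣW_p⟩₀`, the
  «plaquette content of the gap»; physically `κ` = the asymptotic-freedom rate `1/(4 N b₀)`).
* `SCAnchorGap βlo` — some coupling `β₁ ≥ βlo` carries a volume-uniform zero-flux lattice gap `m > 0` (known for `β₁` inside the
  strong-coupling window, Osterwalder–Seiler 1978; recorded here as a hypothesis, not re-proved).
* `UniformRateGap κ` — eventually in `β`, EVERY box `L ≥ 8` has zero-flux gap `≥ c · e^{−κ β} · L` in box units (`= c e^{−κβ}` in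
  lattice units): the summit-strength uniform gap with rate.
* `uniformRateGap_of_heredity : GapHeredityUp βlo κ C → 0 < C → SCAnchorGap βlo → UniformRateGap κ` (PROVED, no `sorry`).

Feeding `PinnedExitsCofinalAt (1/24)` from `UniformRateGap κ` would additionally need `e^{−κβ} ≳ a(β)` cofinally (the AF-rate
promptness of the floor unit, barrier X4 `PerturbativeInvisibility`) and the density-of-states conversion (`GapToPuritySC`-type,
lens-4 `IsRatioDatum`); both are existing rows, so nothing is composed further here.
-/

open MeasureTheory Filter Topology
open Literature.MathematicalPhysics.QuantumFieldTheory Literature.MathematicalPhysics.QuantumLattice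
open Summit.QuantumFields.YangMills.Cruxes.IR.ConformalExit (BoxGapAtLeast boxGapAtLeast_mono)
open Summit.QuantumFields.YangMills.Theorems.FemtoTransferGap (topValue secondValue topValue_nonneg)

namespace Summit.QuantumFields.YangMills.Cruxes.IRcof.FemtoToBulkG1

/-- **(HF) `GapHeredityUp βlo κ C` — β-heredity of the zero-flux box gap at fixed lattice size (integrated Hellmann–Feynman law).**
For simply-connected compact simple `G` and every `r`: for all `L ≥ 8` and `βlo ≤ β₁ ≤ β₂`, a zero-flux gap `≥ z` (box units) at
`β₁` persists at `β₂` as `≥ e^{−κ(β₂−β₁)} z / C`.  [physically: `d log Δ_L/dβ ≥ −κ` up to the constant `C`; `κ ≈ 2.69` for `SU(2)`,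
`β = 4/g²`.]  No gap content by itself (free photons satisfy it); G-visible only through `κ`. -/
def GapHeredityUp (βlo κ C : ℝ) : Prop :=
  ∀ (G : Type) [Group G] [TopologicalSpace G] [IsTopologicalGroup G] [CompactSpace G],
    IsCompactSimpleLieGroup G → SimplyConnectedSpace G →
    letI : MeasurableSpace G := borel G
    haveI : BorelSpace G := ⟨rfl⟩
    ∀ r : LatticeRep G, ∀ (L : ℕ) [NeZero L], 8 ≤ L → ∀ β₁ β₂ : ℝ, βlo ≤ β₁ → β₁ ≤ β₂ →
      ∀ z : ℝ, BoxGapAtLeast r.ρ β₁ L z → BoxGapAtLeast r.ρ β₂ L (Real.exp (-(κ * (β₂ - β₁))) * z / C)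

/-- **`SCAnchorGap βlo` — a volume-uniform zero-flux lattice gap at SOME coupling `β₁ ≥ βlo`** (hypothesis; known inside the
strong-coupling window by the cluster expansion [Osterwalder–Seiler 1978], i.e. usable iff `βlo` lies inside that window). -/
def SCAnchorGap (βlo : ℝ) : Prop :=
  ∀ (G : Type) [Group G] [TopologicalSpace G] [IsTopologicalGroup G] [CompactSpace G],
    IsCompactSimpleLieGroup G → SimplyConnectedSpace G →
    letI : MeasurableSpace G := borel G
    haveI : BorelSpace G := ⟨rfl⟩
    ∀ r : LatticeRep G, ∃ β₁ : ℝ, βlo ≤ β₁ ∧ ∃ m : ℝ, 0 < m ∧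
      ∀ (L : ℕ) [NeZero L], 8 ≤ L → BoxGapAtLeast r.ρ β₁ L (m * L)

/-- **`UniformRateGap κ` — the summit-strength statement in transfer currency**: eventually in `β`, EVERY box `L ≥ 8` has zero-flux
gap `≥ c e^{−κβ} L` in box units, i.e. `≥ c e^{−κβ}` in lattice units, uniformly in the volume (Chatterjee's Problem 5.1(i) with an
explicit rate; NOT implied by `PinnedExitsCofinalAt`, and implying its gap half whenever `e^{−κβ} ≳ a(β)`). -/
def UniformRateGap (κ : ℝ) : Prop :=
  ∀ (G : Type) [Group G] [TopologicalSpace G] [IsTopologicalGroup G] [CompactSpace G],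
    IsCompactSimpleLieGroup G → SimplyConnectedSpace G →
    letI : MeasurableSpace G := borel G
    haveI : BorelSpace G := ⟨rfl⟩
    ∀ r : LatticeRep G, ∃ c : ℝ, 0 < c ∧ ∃ β₀ : ℝ, ∀ β : ℝ, β₀ ≤ β →
      ∀ (L : ℕ) [NeZero L], 8 ≤ L → BoxGapAtLeast r.ρ β L (c * Real.exp (-(κ * β)) * L)

/-- **COSTUME CERTIFICATE (proved).**  β-heredity + the strong-coupling anchor = the volume-uniform lattice gap with explicit rate `κ`.
Hence `GapHeredityUp` is not a femto→bulk transfer law weaker than the load: its only use toward `PinnedExitsCofinalAt (1/24)` runs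
through a statement at least as strong as the summit's lattice form. -/
theorem uniformRateGap_of_heredity {βlo κ C : ℝ} (hH : GapHeredityUp βlo κ C) (hC : 0 < C) (hA : SCAnchorGap βlo) :
    UniformRateGap κ := by
  intro G _ _ _ _ hG hsc
  letI : MeasurableSpace G := borel G
  haveI : BorelSpace G := ⟨rfl⟩
  intro r
  obtain ⟨β₁, hlo, m, hm, hgap⟩ := hA G hG hsc r
  refine ⟨m * Real.exp (κ * β₁) / C, by positivity, β₁, fun β hβ L _ hL => ?_⟩
  have h := hH G hG hsc r L hL β₁ β hlo hβ (m * L) (hgap L hL)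
  refine boxGapAtLeast_mono r.ρ β L (le_of_eq ?_) (topValue_nonneg _ _ _) h
  have : Real.exp (-(κ * (β - β₁))) = Real.exp (κ * β₁) * Real.exp (-(κ * β)) := by
    rw [← Real.exp_add]; congr 1; ring
  rw [this]; field_simp

end Summit.QuantumFields.YangMills.Cruxes.IRcof.FemtoToBulkG1
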